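import Literature.Combinatorics.Enumerative.MatrixForestTheoremInverse
import Mathlib.LinearAlgebra.Matrix.Charpoly.Coeff
import Mathlib.RingTheory.Polynomial.Vieta
import Literature.Analysis.Matrix.DetAddDiagonalMinors
import HarnessLib

/-!
# The forest expansion of the characteristic polynomial of a weighted digraph Laplacian
# (Chebotarev–Agaev 2002, §3 Proposition 2 and Corollaries 1–2, after Kelmans and Fiedler–Sedláček)

Lane `lit-hodgefound`, seat p23, generation 47, row g47-#7 of the programme «Tree and forest formulas
for finite Markov chains» — the all-coefficients form of the matrix-forest theorem, in the vocabulary of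
`Combinatorics/SimpleGraph/WeightedMatrixForestTheorem` (`wLaplacian a`, arbitrary arc weights
`a : V → V → S` over a commutative ring) and `Combinatorics/Enumerative/MatrixForestTheoremInverse`
(`forestWeight a R = w(R)`, the total weight `Σ_{roots(f) = R} ∏_{v ∉ R} a v (f v)` of the in-forests with
root set `R`; `det_wLaplacian_submatrix_eq_forestWeight : det L(R̄ | R̄) = w(R)`).

## Source, verbatim ([ChebotarevAgaev2002] = P. Chebotarev, R. Agaev, *Forest matrices around the
Laplacian matrix*, Linear Algebra Appl. 356 (2002) 253–274, held text `paper:arxiv-math_0508178`, §2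
p. 4 and §3 p. 6)

«By `F→*(Γ) = F→*` and `F→*_k(Γ) = F→*_k` we denote the set of all in-forests of `Γ` and the set of all
in-forests of `Γ` with `k` arcs, respectively […] in general, the number of disjoint trees in a spanning
forest with `k` arcs is `n − k`. […] Let `σ_k = ε(F→*_k)`, `k = 0, 1, …` […]
**Theorem 2** [Fiedler–Sedláček]. For any `J ⊆ {1,…,n}`, `det L(J̄ | J̄) = ε(F→*J)` holds, where `F→*J` is
the set of in-forests for which `J` is the set of roots. […]
Let `p(λ) = det(λI + L) = Σ_{k=0}^n c_{n−k} λ^k` be the characteristic polynomial of `−L` and let `σ_k` be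
as defined in (sik). **Proposition 2.** In (p(λ)), `c_k = σ_k`, `k = 0, …, n`. In view of Theorem 2, this
proposition follows from the fact that `c_k` is equal to the sum of the `k × k` principal minors of `L`.
In the case of undirected unweighted multigraphs, Proposition 2 is due to Kelmans […]
Since `σ_k = 0` if and only if `k > n − d` (`k = 0, 1, …`), Proposition 2 implies **Corollary 1.** The
multiplicity of `0` as the eigenvalue of `L` is `d`. Another immediate consequence of Proposition 2 is
**Corollary 2.** `σ_k = Σ_{J : |J| = k} ∏_{j ∈ J} λ_j`, `k = 0, …, n`, where `λ_1, ⋯, λ_n` are the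
eigenvalues of `L` and `J` are the subsets of `{1, ⋯, n}`.»

## Dictionary

An in-forest with `k` arcs on `n` vertices has `n − k` trees, i.e. `n − k` roots; so
`σ_k = Σ_{|R| = n − k} w(R)` and the coefficient of `λ^k` in `p(λ) = det(λI + L) = χ_{−L}(λ)` is
`c_{n−k} = σ_{n−k} = Σ_{|R| = k} w(R)`; for `χ_L(X) = det(XI − L) = (−1)^n p(−X)` the coefficient of `X^k`
is `(−1)^{n−k} Σ_{|R| = k} w(R)`.

## What is here

* `sum_powersetCard_compl` — re-indexing `Σ_{|R| = k} f(Rᶜ) = Σ_{|s| = n−k} f(s)`;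
* **`charpoly_wLaplacian_coeff`** — `[X^k] χ_L = (−1)^{n−k} Σ_{|R|=k} w(R)` for every `k` (Proposition 2
  for `χ_L`), and **`charpoly_neg_wLaplacian_coeff`** — `[λ^k] det(λI + L) = Σ_{|R|=k} w(R)`, i.e.
  `c_{n−k} = σ_{n−k}` (Proposition 2 as printed); the polynomial identities `charpoly_wLaplacian_eq_sum`,
  `charpoly_neg_wLaplacian_eq_sum`;
* the extreme coefficients: `sum_forestWeight_card_univ` (`σ_0 = 1`), `sum_forestWeight_card_sub_one`
  (`σ_1 = tr L = Σ_u Σ_{w ≠ u} a u w`, the total arc weight);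
* **`rootMultiplicity_zero_charpoly_wLaplacian`** — Corollary 1 in algebraic form: the multiplicity of
  the eigenvalue `0` of `L` is the least `k` with `Σ_{|R| = k} w(R) ≠ 0`;
* **`sum_forestWeight_eq_esymm_roots`** — Corollary 2: over a field in which `χ_L` splits with root
  multiset `μ`, `Σ_{|R| = k} w(R) = e_{n−k}(μ)`;
* §3 (appended, row g47-#9) — **Corollary 1 as printed, for non-negative weights**: with the in-forest
  dimension `d` := the least number of trees (roots) of a spanning in-forest all of whose arcs have positive
  weight, `ChebotarevAgaev2002_cor_1` — the multiplicity of `0` as a root of `χ_L` is `d`; and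
  `ChebotarevAgaev2002_sigma_pos_iff` — «`σ_k = 0` if and only if `k > n − d`» (`Σ_{|R| = j} w(R) > 0 ↔
  d ≤ j`), through arc deletion (`IsForestOn.update_self_insert`) and `forestWeight_nonneg_of_nonneg`
  («all the principal minors of `L` are nonnegative»).

* §4 (appended, row g47-#12) — **the matrix-forest theorems for determinants**:
  `det_wLaplacian_add_diagonal` — the multivariate generating function
  **`det(L + diag z) = Σ_R (∏_{r ∈ R} z_r) · w(R)`** over all root sets (Borcea–Brändén–Liggett's
  `f_G(z, w) = det(L(G) + Z) = Σ_F z^{roots(F)} w^{edges(F)}`, here for arc-weighted digraphs), from the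
  tree's principal-minor expansion `det_add_diagonal_eq_sum_minors` and Theorem 2; whence Chebotarev–Agaev's
  **Theorem 3′** `σ(τ) = det(I + τL) = Σ_k τ^k σ_k` (`det_one_add_smul_wLaplacian`) and **Theorem 3**
  `σ = det(I + L)` = the total weight of ALL spanning in-forests (`det_one_add_wLaplacian`).

THEOREMS ONLY (no definition, no named fact, no instance).

## References

* [ChebotarevAgaev2002] §2 (σ_k), §3 Theorem 2, Proposition 2, Corollaries 1–2; §4 Theorem 3
  («`Q = adj(I+L)` and `σ = det(I+L)`»), Theorem 3′ («`σ(τ) = det(I + τL)`»).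
* [BorceaBrandenLiggett2007] §3.4 (`f_G(z,w) = det(L(G) + Z) = Σ_F z^{roots(F)} w^{edges(F)}`).
* Tree: `Analysis/Matrix/DetAddDiagonalMinors` (`det_add_diagonal_eq_sum_minors`).
* [PitmanTang2018] §4.1 (the case `k = 1`: `−tr adj(L) = −Σ_i det L(i) = −Σ^{(1)}`), Theorem 1.2.
* Mathlib: `Matrix.charpoly_coeff_eq_sum_minors` (coefficients = signed sums of principal minors),
  `Polynomial.coeff_eq_esymm_roots_of_splits` (Vieta), `Polynomial.rootMultiplicity_eq_natTrailingDegree'`.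
-/

namespace Literature.Combinatorics.Enumerative

open Finset Matrix Polynomial Literature.Combinatorics.SimpleGraph.WeightedMatrixForest

variable {V : Type*} [Fintype V] [DecidableEq V]

/-! ### §1 All coefficients of `χ_L` are forest sums (Proposition 2) -/

section CommRing

variable {S : Type*} [CommRing S] (a : V → V → S)

/-- Re-indexing the `k`-subsets by their complements: `Σ_{|R| = k} f(Rᶜ) = Σ_{|s| = n − k} f(s)`.
[cite: ChebotarevAgaev2002, §2 («the number of disjoint trees in a spanning forest with `k` arcs is
`n − k`»)] -/
theorem sum_powersetCard_compl {M : Type*} [AddCommMonoid M] (f : Finset V → M) {k : ℕ}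
    (hk : k ≤ Fintype.card V) :
    ∑ R ∈ (univ : Finset V).powersetCard k, f Rᶜ =
      ∑ s ∈ (univ : Finset V).powersetCard (Fintype.card V - k), f s := by
  refine sum_nbij' (fun R => Rᶜ) (fun s => sᶜ) ?_ ?_ ?_ ?_ fun _ _ => rfl
  · intro R hR
    rw [mem_powersetCard_univ] at hR ⊢
    rw [card_compl, hR]
  · intro s hs
    rw [mem_powersetCard_univ] at hs ⊢
    rw [card_compl, hs, Nat.sub_sub_self hk]
  · intro R _
    exact compl_compl R
  · intro s _
    exact compl_compl s

/-- **Proposition 2 for `χ_L(X) = det(XI − L)`: the coefficient of `X^k` is `(−1)^{n−k} Σ_{|R| = k} w(R)`**,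
the signed total weight of the in-forests with `k` roots (`n − k` arcs) — for every `k` (both sides vanish
for `k > n`). From «`c_k` is equal to the sum of the `k × k` principal minors of `L`» (Mathlib's
`Matrix.charpoly_coeff_eq_sum_minors`) and Theorem 2 (`det L(R̄ | R̄) = w(R)`, the tree's
`det_wLaplacian_submatrix_eq_forestWeight`). [cite: ChebotarevAgaev2002, §3 Proposition 2 with Theorem 2] -/
theorem charpoly_wLaplacian_coeff (k : ℕ) :
    (wLaplacian a).charpoly.coeff k =
      (-1) ^ (Fintype.card V - k) * ∑ R ∈ (univ : Finset V).powersetCard k, forestWeight a R := by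
  rcases le_or_gt k (Fintype.card V) with hk | hk
  · have h := Matrix.charpoly_coeff_eq_sum_minors (wLaplacian a) (Fintype.card V - k) (Nat.sub_le _ _)
    rw [Nat.sub_sub_self hk] at h
    rw [h]
    congr 1
    rw [← sum_powersetCard_compl _ hk]
    exact sum_congr rfl fun R _ => det_wLaplacian_submatrix_eq_forestWeight a R
  · nontriviality S
    rw [coeff_eq_zero_of_natDegree_lt (by rw [charpoly_natDegree_eq_dim]; exact hk),
      powersetCard_eq_empty.2 (by rwa [card_univ]), sum_empty, mul_zero]

/-- **Proposition 2 as printed: in `p(λ) = det(λI + L) = Σ_k c_{n−k} λ^k`, the characteristic polynomial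
of `−L`, `c_k = σ_k`** — the coefficient of `λ^k` is `σ_{n−k} = Σ_{|R| = k} w(R)`, the total weight of
the in-forests with `n − k` arcs (`k` roots), with no sign. [cite: ChebotarevAgaev2002, §3 Proposition 2] -/
theorem charpoly_neg_wLaplacian_coeff (k : ℕ) :
    (-wLaplacian a).charpoly.coeff k = ∑ R ∈ (univ : Finset V).powersetCard k, forestWeight a R := by
  rcases le_or_gt k (Fintype.card V) with hk | hk
  · have h := Matrix.charpoly_coeff_eq_sum_minors (-wLaplacian a) (Fintype.card V - k) (Nat.sub_le _ _)
    rw [Nat.sub_sub_self hk] at h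
    rw [h, ← sum_powersetCard_compl _ hk, mul_sum]
    refine sum_congr rfl fun R hR => ?_
    have hc : Fintype.card ↥(Rᶜ) = Fintype.card V - k := by
      rw [Fintype.card_coe, card_compl, mem_powersetCard_univ.1 hR]
    rw [show (-wLaplacian a).submatrix (Subtype.val : ↥(Rᶜ) → V) Subtype.val
        = -((wLaplacian a).submatrix Subtype.val Subtype.val) from rfl, det_neg, hc, ← mul_assoc,
      ← pow_add, ← two_mul, pow_mul, neg_one_sq, one_pow, one_mul,
      det_wLaplacian_submatrix_eq_forestWeight]
  · nontriviality S
    rw [coeff_eq_zero_of_natDegree_lt (by rw [charpoly_natDegree_eq_dim]; exact hk),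
      powersetCard_eq_empty.2 (by rwa [card_univ]), sum_empty]

/-- **`χ_L(X) = Σ_{k=0}^{n} (−1)^{n−k} σ_{n−k} X^k`**, `σ_{n−k} = Σ_{|R| = k} w(R)`.
[cite: ChebotarevAgaev2002, §3 Proposition 2 (eq. (p(λ)))] -/
theorem charpoly_wLaplacian_eq_sum :
    (wLaplacian a).charpoly = ∑ k ∈ range (Fintype.card V + 1),
      C ((-1) ^ (Fintype.card V - k) * ∑ R ∈ (univ : Finset V).powersetCard k, forestWeight a R) *
        X ^ k := by
  rcases subsingleton_or_nontrivial S with hS | hS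
  · exact Subsingleton.elim _ _
  conv_lhs => rw [(wLaplacian a).charpoly.as_sum_range_C_mul_X_pow, charpoly_natDegree_eq_dim]
  simp_rw [charpoly_wLaplacian_coeff]

/-- **`p(λ) = det(λI + L) = Σ_{k=0}^{n} c_{n−k} λ^k` with `c_{n−k} = σ_{n−k} = Σ_{|R| = k} w(R)`** (as a
polynomial identity for `χ_{−L}`). [cite: ChebotarevAgaev2002, §3 Proposition 2 (eq. (p(λ)))] -/
theorem charpoly_neg_wLaplacian_eq_sum :
    (-wLaplacian a).charpoly = ∑ k ∈ range (Fintype.card V + 1),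
      C (∑ R ∈ (univ : Finset V).powersetCard k, forestWeight a R) * X ^ k := by
  rcases subsingleton_or_nontrivial S with hS | hS
  · exact Subsingleton.elim _ _
  conv_lhs => rw [(-wLaplacian a).charpoly.as_sum_range_C_mul_X_pow, charpoly_natDegree_eq_dim]
  simp_rw [charpoly_neg_wLaplacian_coeff]

/-- `σ_0 = 1`: the empty in-forest (`n` roots) — the leading coefficient.
[cite: ChebotarevAgaev2002, §2 («`σ_0 = 1`» in (sik): `ε(∅-arc forest) = 1`)] -/
theorem sum_forestWeight_card_univ :
    ∑ R ∈ (univ : Finset V).powersetCard (Fintype.card V), forestWeight a R = 1 := by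
  rw [← card_univ, powersetCard_self, sum_singleton, forestWeight_univ]

/-- **`σ_1 = tr L`**: the in-forests with one arc are the arcs, so `Σ_{|R| = n−1} w(R) = Σ_u Σ_{w ≠ u} a u w`,
the total arc weight — here read off from `[X^{n−1}] χ_L = −tr L`.
[cite: ChebotarevAgaev2002, §3 Proposition 2 (`k = 1`: `c_1 = tr L = σ_1`)] -/
theorem sum_forestWeight_card_sub_one [Nonempty V] :
    ∑ R ∈ (univ : Finset V).powersetCard (Fintype.card V - 1), forestWeight a R =
      ∑ u, ∑ w ∈ univ.erase u, a u w := by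
  have h := Matrix.trace_eq_neg_charpoly_coeff (wLaplacian a)
  rw [charpoly_wLaplacian_coeff, Nat.sub_sub_self Fintype.card_pos, pow_one, neg_one_mul, neg_neg] at h
  rw [← h, Matrix.trace]
  exact sum_congr rfl fun u _ => wLaplacian_apply_self a u

/-- **Corollary 1 (algebraic form): the multiplicity of `0` as a root of `χ_L` is the least `k` with
`σ_{n−k} = Σ_{|R| = k} w(R) ≠ 0`** (for nonnegative real weights: the in-forest dimension `d`, the least
number of trees in a spanning in-forest). [cite: ChebotarevAgaev2002, §3 Corollary 1 («The multiplicity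
of `0` as the eigenvalue of `L` is `d`»; with «`σ_k = 0` if and only if `k > n − d`»)] -/
theorem rootMultiplicity_zero_charpoly_wLaplacian {k : ℕ}
    (hlt : ∀ j < k, ∑ R ∈ (univ : Finset V).powersetCard j, forestWeight a R = 0)
    (hk : ∑ R ∈ (univ : Finset V).powersetCard k, forestWeight a R ≠ 0) :
    (wLaplacian a).charpoly.rootMultiplicity 0 = k := by
  rcases subsingleton_or_nontrivial S with hS | hS
  · exact absurd (Subsingleton.elim _ _) hk
  rw [rootMultiplicity_eq_natTrailingDegree']
  refine le_antisymm (natTrailingDegree_le_of_ne_zero ?_)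
    (le_natTrailingDegree (charpoly_monic _).ne_zero fun j hj => ?_)
  · rw [charpoly_wLaplacian_coeff]
    exact fun h => hk ((((isUnit_one.neg).pow _).mul_right_eq_zero).1 h)
  · rw [charpoly_wLaplacian_coeff, hlt j hj, mul_zero]

end CommRing

/-! ### §2 Corollary 2: `σ_k = e_k(λ_1, …, λ_n)` -/

section Field

variable {K : Type*} [Field K] (a : V → V → K)

/-- **Corollary 2: `σ_k = Σ_{|J| = k} ∏_{j ∈ J} λ_j`**, the `k`-th elementary symmetric function of the
eigenvalues `λ_1, …, λ_n` of `L` — here: in a field over which `χ_L` splits, with `μ = χ_L.roots` (the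
eigenvalues with multiplicity), `Σ_{|R| = k} w(R) = σ_{n−k} = e_{n−k}(μ)` for `k ≤ n`.
[cite: ChebotarevAgaev2002, §3 Corollary 2] -/
theorem sum_forestWeight_eq_esymm_roots (hsplit : (wLaplacian a).charpoly.Splits) {k : ℕ}
    (hk : k ≤ Fintype.card V) :
    ∑ R ∈ (univ : Finset V).powersetCard k, forestWeight a R =
      (wLaplacian a).charpoly.roots.esymm (Fintype.card V - k) := by
  have hdeg := (wLaplacian a).charpoly_natDegree_eq_dim
  have h := Polynomial.coeff_eq_esymm_roots_of_splits hsplit (k := k) (by rw [hdeg]; exact hk)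
  rw [(wLaplacian a).charpoly_monic.leadingCoeff, one_mul, hdeg, charpoly_wLaplacian_coeff] at h
  exact ((isUnit_one.neg).pow _).mul_right_injective h

end Field

/-! ### §3 Corollary 1 as printed: non-negative weights, the in-forest dimension `d` -/

section Nonneg

variable {S : Type*} [CommRing S] [LinearOrder S] [IsStrictOrderedRing S] (a : V → V → S)

/-- For non-negative arc weights every forest sum is non-negative («all the principal minors of `L` are
nonnegative»). [cite: ChebotarevAgaev2002, §3 («One of the consequences is that all the principal minors
of `L` are nonnegative»)] -/
theorem forestWeight_nonneg_of_nonneg (ha : ∀ x y, 0 ≤ a x y) (R : Finset V) : 0 ≤ forestWeight a R := by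
  rw [forestWeight_def]
  exact sum_nonneg fun τ _ => prod_nonneg fun v _ => ha _ _

/-- A spanning in-forest with root set `R` and positive arc weights makes `σ_{n−|R|} = Σ_{|R'| = |R|} w(R')`
positive. [cite: ChebotarevAgaev2002, §2 eq. (sik) (`σ_k = ε(F→*_k) > 0` iff `F→*_k ≠ ∅` for positive
weights)] -/
theorem sum_forestWeight_pos_of_forest (ha : ∀ x y, 0 ≤ a x y) {R : Finset V} {τ : V → V}
    (hτ : IsForestOn (univ : Finset V) R τ) (hpos : ∀ v ∉ R, 0 < a v (τ v)) :
    0 < ∑ R' ∈ (univ : Finset V).powersetCard R.card, forestWeight a R' := by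
  have hR : R ∈ (univ : Finset V).powersetCard R.card := mem_powersetCard_univ.2 rfl
  refine lt_of_lt_of_le ?_ (single_le_sum (fun R' _ => forestWeight_nonneg_of_nonneg a ha R') hR)
  rw [forestWeight_def]
  refine lt_of_lt_of_le ?_
    (single_le_sum (fun τ' _ => prod_nonneg fun v _ => ha v (τ' v)) (mem_forests.2 hτ))
  exact prod_pos fun v hv => hpos v (mem_compl.1 hv)

omit [IsStrictOrderedRing S] in
/-- If every positive spanning in-forest has at least `d` roots, then `σ_{n−j} = 0` for `j < d` (each forest
with fewer roots has an arc of weight `0`). [cite: ChebotarevAgaev2002, §2 («`σ_k = 0` whenever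
`k > n − d`»)] -/
theorem sum_forestWeight_eq_zero_of_lt (ha : ∀ x y, 0 ≤ a x y) {d j : ℕ}
    (hmin : ∀ (R : Finset V) (τ : V → V), IsForestOn (univ : Finset V) R τ →
      (∀ v ∉ R, 0 < a v (τ v)) → d ≤ R.card)
    (hj : j < d) :
    ∑ R ∈ (univ : Finset V).powersetCard j, forestWeight a R = 0 := by
  refine sum_eq_zero fun R hR => ?_
  rw [forestWeight_def]
  refine sum_eq_zero fun τ hτ => ?_
  by_contra hne
  have hpos : ∀ v ∉ R, 0 < a v (τ v) := fun v hv =>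
    lt_of_le_of_ne (ha _ _) fun h => hne (prod_eq_zero (mem_compl.2 hv) h.symm)
  have h := hmin R τ (mem_forests.1 hτ) hpos
  rw [mem_powersetCard_univ.1 hR] at h
  omega

omit [IsStrictOrderedRing S] in
/-- Arc deletion: from a positive spanning in-forest with root set `R`, positive spanning in-forests with
any number `k` of roots, `|R| ≤ k ≤ n` (delete arcs one at a time; each deleted tail becomes a root).
[cite: ChebotarevAgaev2002, §2 («the number of disjoint trees in a spanning forest with `k` arcs is
`n − k`»; `F→*_k ≠ ∅` for `k ≤ n − d`)] -/
theorem exists_posForest_of_card_le {R : Finset V} {τ : V → V} (hτ : IsForestOn (univ : Finset V) R τ)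
    (hpos : ∀ v ∉ R, 0 < a v (τ v)) {k : ℕ} (hRk : R.card ≤ k) (hk : k ≤ Fintype.card V) :
    ∃ (R' : Finset V) (τ' : V → V), R'.card = k ∧ IsForestOn (univ : Finset V) R' τ' ∧
      ∀ v ∉ R', 0 < a v (τ' v) := by
  induction k, hRk using Nat.le_induction with
  | base => exact ⟨R, τ, rfl, hτ, hpos⟩
  | succ k hRk ih =>
    obtain ⟨R', τ', hcard, hτ', hpos'⟩ := ih (Nat.le_of_succ_le hk)
    obtain ⟨x, hx⟩ : ∃ x, x ∉ R' := by
      by_contra h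
      push Not at h
      have hu : R' = univ := eq_univ_iff_forall.2 h
      rw [hu, card_univ] at hcard
      omega
    refine ⟨insert x R', Function.update τ' x x, by rw [card_insert_of_notMem hx, hcard],
      hτ'.update_self_insert x, fun v hv => ?_⟩
    rw [mem_insert, not_or] at hv
    rw [Function.update_of_ne hv.1]
    exact hpos' v hv.2

/-- **Corollary 1 (as printed): the multiplicity of `0` as the eigenvalue of `L` is `d`**, the in-forest
dimension — for non-negative arc weights, `d` the least number of trees of a spanning in-forest of the
digraph of positive-weight arcs (given here by a witness with `d` roots and minimality).
[cite: ChebotarevAgaev2002, §3 Corollary 1] -/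
theorem ChebotarevAgaev2002_cor_1 (ha : ∀ x y, 0 ≤ a x y) {d : ℕ}
    (hex : ∃ (R : Finset V) (τ : V → V), R.card = d ∧ IsForestOn (univ : Finset V) R τ ∧
      ∀ v ∉ R, 0 < a v (τ v))
    (hmin : ∀ (R : Finset V) (τ : V → V), IsForestOn (univ : Finset V) R τ →
      (∀ v ∉ R, 0 < a v (τ v)) → d ≤ R.card) :
    (wLaplacian a).charpoly.rootMultiplicity 0 = d := by
  obtain ⟨R, τ, hRd, hτ, hpos⟩ := hex
  refine rootMultiplicity_zero_charpoly_wLaplacian a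
    (fun j hj => sum_forestWeight_eq_zero_of_lt a ha hmin hj) ?_
  rw [← hRd]
  exact (sum_forestWeight_pos_of_forest a ha hτ hpos).ne'

/-- **«`σ_k = 0` if and only if `k > n − d`»**: for non-negative weights with in-forest dimension `d`,
`Σ_{|R| = j} w(R) > 0 ↔ d ≤ j` (`j ≤ n`). [cite: ChebotarevAgaev2002, §3 (proof of Corollary 1: «Since
`σ_k = 0` if and only if `k > n − d`»)] -/
theorem ChebotarevAgaev2002_sigma_pos_iff (ha : ∀ x y, 0 ≤ a x y) {d : ℕ}
    (hex : ∃ (R : Finset V) (τ : V → V), R.card = d ∧ IsForestOn (univ : Finset V) R τ ∧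
      ∀ v ∉ R, 0 < a v (τ v))
    (hmin : ∀ (R : Finset V) (τ : V → V), IsForestOn (univ : Finset V) R τ →
      (∀ v ∉ R, 0 < a v (τ v)) → d ≤ R.card)
    {j : ℕ} (hj : j ≤ Fintype.card V) :
    0 < ∑ R ∈ (univ : Finset V).powersetCard j, forestWeight a R ↔ d ≤ j := by
  constructor
  · intro h
    by_contra hlt
    push Not at hlt
    exact h.ne' (sum_forestWeight_eq_zero_of_lt a ha hmin hlt)
  · intro hdj
    obtain ⟨R, τ, hRd, hτ, hpos⟩ := hex
    obtain ⟨R', τ', hcard, hτ', hpos'⟩ := exists_posForest_of_card_le a hτ hpos (hRd ▸ hdj) hj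
    rw [← hcard]
    exact sum_forestWeight_pos_of_forest a ha hτ' hpos'

end Nonneg

/-! ### §4 The matrix-forest theorems for determinants: `det(L + diag z)`, `det(I + τL)`, `det(I + L)` -/

section MatrixForest

variable {S : Type*} [CommRing S] (a : V → V → S)

/-- **`det(L + diag z) = Σ_R (∏_{r ∈ R} z_r) · w(R)`** — the multivariate spanning-forest generating
function of an arc-weighted digraph (sum over all root sets `R`; `w(R)` the total weight of the
in-forests with root set `R`): Borcea–Brändén–Liggett's `f_G(z,w) = det(L(G) + Z) = Σ_F z^{roots(F)}
w^{edges(F)}`, by the principal-minor expansion of `det(M + diag z)` and Theorem 2 (`det L(J̄|J̄) = ε(F→*J)`).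
[cite: BorceaBrandenLiggett2007, §3.4 (`f_G(z,w) = det(L(G) + Z)`)] [cite: ChebotarevAgaev2002, §3
Theorem 2] -/
theorem det_wLaplacian_add_diagonal (z : V → S) :
    (wLaplacian a + diagonal z).det = ∑ R : Finset V, (∏ r ∈ R, z r) * forestWeight a R := by
  rw [Literature.Analysis.Matrix.det_add_diagonal_eq_sum_minors]
  refine Fintype.sum_bijective _ compl_bijective _ _ fun s => ?_
  rw [det_wLaplacian_submatrix, forestWeight_def, compl_compl]

/-- Scaling all arc weights scales the Laplacian. [cite: ChebotarevAgaev2002, §4 (proof of Theorem 3′: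
«the weighted digraph `Γ′(τ)` that differs from `Γ` in the weights of arcs only: `ε′_{ij}(τ) = τ ε_{ij}`»)] -/
theorem wLaplacian_smul (t : S) : wLaplacian (fun u v => t * a u v) = t • wLaplacian a := by
  ext u v
  by_cases h : u = v
  · subst h
    rw [wLaplacian_apply_self, Matrix.smul_apply, wLaplacian_apply_self, smul_eq_mul, mul_sum]
  · rw [wLaplacian_apply_of_ne _ h, Matrix.smul_apply, wLaplacian_apply_of_ne _ h, smul_eq_mul,
      mul_neg]

/-- Scaling all arc weights by `τ` scales `w(R)` by `τ^{n − |R|}` (an in-forest with root set `R` has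
`n − |R|` arcs). [cite: ChebotarevAgaev2002, §4 (proof of Theorem 3′) with §2 («the number of disjoint
trees in a spanning forest with `k` arcs is `n − k`»)] -/
theorem forestWeight_smul (t : S) (R : Finset V) :
    forestWeight (fun u v => t * a u v) R = t ^ (Fintype.card V - R.card) * forestWeight a R := by
  rw [forestWeight_def, forestWeight_def, mul_sum]
  refine sum_congr rfl fun τ _ => ?_
  rw [prod_mul_distrib, prod_const, card_compl]

/-- **Theorem 3′ (parametric matrix-forest theorem), determinant part: `σ(τ) = det(I + τL) =
Σ_R τ^{n−|R|} w(R) = Σ_k τ^k σ_k`**, for every `τ` in any commutative ring.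
[cite: ChebotarevAgaev2002, §4 Theorem 3′ («`σ(τ) = det(I + τL)`»)] -/
theorem det_one_add_smul_wLaplacian (t : S) :
    (1 + t • wLaplacian a).det = ∑ R : Finset V, t ^ (Fintype.card V - R.card) * forestWeight a R := by
  have h := det_wLaplacian_add_diagonal (fun u v => t * a u v) (fun _ => 1)
  rw [wLaplacian_smul] at h
  rw [add_comm, show (1 : Matrix V V S) = diagonal fun _ => 1 from diagonal_one.symm, h]
  refine sum_congr rfl fun R _ => ?_
  rw [prod_const_one, one_mul, forestWeight_smul]

/-- **Theorem 3 (the matrix-forest theorem of Chebotarev–Shamis), determinant part: `σ = det(I + L)`**,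
the total weight of ALL spanning in-forests of the weighted digraph (`σ = Σ_k σ_k = Σ_R w(R)`).
[cite: ChebotarevAgaev2002, §4 Theorem 3 («`Q = adj(I+L)` and `σ = det(I+L)`»)] -/
theorem det_one_add_wLaplacian :
    (1 + wLaplacian a).det = ∑ R : Finset V, forestWeight a R := by
  have h := det_one_add_smul_wLaplacian a 1
  rw [one_smul] at h
  rw [h]
  exact sum_congr rfl fun R _ => by rw [one_pow, one_mul]

end MatrixForest

end Literature.Combinatorics.Enumerative
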